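import Mathlib
import Summits.ResolutionOfSingularities.ResolutionOfSingularities.Theses.TropicalLinks

/-!
# Birth skeleton (BC3) — piece `SncBoundaryClosure` (child 2/3 of the BC2 split of
`TropicalLinks.InductiveStep`)

Line "components first, crossings second" (weak embedded resolution of the hyperplane at infinity of a
regular projective closure, in two classical stages): (stub 1) reach a regular projective closure of some
principal open whose boundary COMPONENTS are regular (componentwise embedded resolution of the boundary
prime divisors, weak/birational form); (stub 2) from regular components reach strict normal crossings
(transversalisation of regular hypersurfaces in a regular projective variety, weak form).
`SncBoundaryClosure_of` composes them (pure logic).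
-/

namespace Summit.ResolutionOfSingularities.ResolutionOfSingularities.Cruxes.SncBoundaryClosure.Birth

set_option linter.dupNamespace false

open scoped BigOperators Topology Manifold Classical MeasureTheory ProbabilityTheory Matrix InnerProductSpace ComplexConjugate ContinuousMap
open Filter Set Function TopologicalSpace MeasureTheory
open AlgebraicGeometry CategoryTheory

/-- Laurent polynomial ring `k[x₁^±, …, x_N^±]`. -/
abbrev Lau (k : Type) [Field k] (N : ℕ) : Type := AddMonoidAlgebra k (Fin N → ℤ)

/-- coordinate ring `A_g = (k[x^±]/I)[g⁻¹]` of the principal open `U_g` of `U = V(I)`. -/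
abbrev Ag {k : Type} [Field k] {N : ℕ} (I : Ideal (Lau k N)) (g : Lau k N) : Type :=
  Localization.Away (Ideal.Quotient.mk I g)

/-- chart-`i` generators `(1/f_i, f_0/f_i, …, f_{n-1}/f_i)` of the projective closure, inside `A_g[1/f_i]`. -/
noncomputable abbrev chartGens {k : Type} [Field k] {N : ℕ} {I : Ideal (Lau k N)} {g : Lau k N} {n : ℕ}
    (f : Fin n → Ag I g) (i : Fin n) : Fin (n + 1) → Localization.Away (f i) :=
  Fin.cons (IsLocalization.Away.invSelf (f i))
    (fun j => algebraMap (Ag I g) (Localization.Away (f i)) (f j) * IsLocalization.Away.invSelf (f i))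

/-- coordinate ring of chart `i` (`x_{i+1} ≠ 0`) of the projective closure of `U_g ↪ 𝔸ⁿ ⊆ ℙⁿ`. -/
abbrev Chart {k : Type} [Field k] {N : ℕ} {I : Ideal (Lau k N)} {g : Lau k N} {n : ℕ}
    (f : Fin n → Ag I g) (i : Fin n) : Type :=
  MvPolynomial (Fin (n + 1)) k ⧸
    RingHom.ker (MvPolynomial.aeval (chartGens f i) : MvPolynomial (Fin (n + 1)) k →ₐ[k] Localization.Away (f i))

/-- local equation `x_0/x_{i+1}` of the hyperplane at infinity in chart `i`. -/
noncomputable abbrev tInf {k : Type} [Field k] {N : ℕ} {I : Ideal (Lau k N)} {g : Lau k N} {n : ℕ}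
    (f : Fin n → Ag I g) (i : Fin n) : Chart f i :=
  Ideal.Quotient.mk _ (MvPolynomial.X 0)

/-- the affine embedding `f` of `U_g` has REGULAR projective closure (all `n + 1` charts regular). -/
def RegularClosureDatum (k : Type) [Field k] {N : ℕ} (I : Ideal (Lau k N)) (g : Lau k N) (n : ℕ)
    (f : Fin n → Ag I g) : Prop :=
  Function.Surjective (MvPolynomial.aeval f : MvPolynomial (Fin n) k →ₐ[k] Ag I g) ∧
  (∀ (P : Ideal (Ag I g)) [P.IsPrime], IsRegularLocalRing (Localization.AtPrime P)) ∧
  ∀ (i : Fin n) (P : Ideal (Chart f i)) [P.IsPrime], IsRegularLocalRing (Localization.AtPrime P)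

/-- the hyperplane at infinity of the closure is a strict normal crossings divisor (Stacks 0BI9, local form). -/
def SncBoundaryDatum (k : Type) [Field k] {N : ℕ} (I : Ideal (Lau k N)) (g : Lau k N) (n : ℕ)
    (f : Fin n → Ag I g) : Prop :=
  ∀ (i : Fin n) (P : Ideal (Chart f i)) [P.IsPrime], tInf f i ∈ P →
    ∃ (r e : ℕ) (x : Fin r → Localization.AtPrime P) (y : Fin e → Localization.AtPrime P),
      1 ≤ r ∧ ringKrullDim (Localization.AtPrime P) = ((r + e : ℕ) : WithBot ℕ∞) ∧
      Ideal.span (Set.range x ∪ Set.range y) = IsLocalRing.maximalIdeal (Localization.AtPrime P) ∧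
      (Ideal.span {algebraMap (Chart f i) (Localization.AtPrime P) (tInf f i)}).radical =
        Ideal.span {∏ l, x l}

section Bridge
variable (k : Type) [Field k] {N : ℕ} (I : Ideal (Lau k N)) (g : Lau k N) (n : ℕ) (f : Fin n → Ag I g)

/-- `RegularClosureDatum` IS the inlined regular-closure clause of the children statements (`Iff.rfl`). -/
theorem regularClosureDatum_iff : RegularClosureDatum k I g n f ↔ (Function.Surjective (MvPolynomial.aeval f : MvPolynomial (Fin n) k →ₐ[k] Localization.Away (Ideal.Quotient.mk I g)) ∧ (∀ (P : Ideal (Localization.Away (Ideal.Quotient.mk I g))) [P.IsPrime], IsRegularLocalRing (Localization.AtPrime P)) ∧ ∀ (i : Fin n) (P : Ideal (MvPolynomial (Fin (n + 1)) k ⧸ RingHom.ker (MvPolynomial.aeval (Fin.cons (IsLocalization.Away.invSelf (f i)) (fun j => algebraMap (Localization.Away (Ideal.Quotient.mk I g)) (Localization.Away (f i)) (f j) * IsLocalization.Away.invSelf (f i)) : Fin (n + 1) → Localization.Away (f i)) : MvPolynomial (Fin (n + 1)) k →ₐ[k] Localization.Away (f i)))) [P.IsPrime], IsRegularLocalRing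 (Localization.AtPrime P)) := Iff.rfl

/-- `SncBoundaryDatum` IS the inlined snc clause of the children statements (`Iff.rfl`). -/
theorem sncBoundaryDatum_iff : SncBoundaryDatum k I g n f ↔ (∀ (i : Fin n) (P : Ideal (MvPolynomial (Fin (n + 1)) k ⧸ RingHom.ker (MvPolynomial.aeval (Fin.cons (IsLocalization.Away.invSelf (f i)) (fun j => algebraMap (Localization.Away (Ideal.Quotient.mk I g)) (Localization.Away (f i)) (f j) * IsLocalization.Away.invSelf (f i)) : Fin (n + 1) → Localization.Away (f i)) : MvPolynomial (Fin (n + 1)) k →ₐ[k] Localization.Away (f i)))) [P.IsPrime], (Ideal.Quotient.mk (RingHom.ker (MvPolynomial.aeval (Fin.cons (IsLocalization.Away.invSelf (f i)) (fun j => algebraMap (Localization.Away (Ideal.Quotient.mk I g)) (Localization.Away (f i)) (f j) * IsLocalization.Away.invSelf (f i)) : Fin (n + 1) → Localization.Away (f i)) : MvPolynomial (Fin (n + 1)) k →ₐ[k] Localization.Away (f i))) (MvPolynomial.X 0) : (MvPolynomial (Fin (n + 1)) k ⧸ RingHom.ker (MvPolynomial.aeval (Fin.cons (IsLocalization.Away.invSelf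 (f i)) (fun j => algebraMap (Localization.Away (Ideal.Quotient.mk I g)) (Localization.Away (f i)) (f j) * IsLocalization.Away.invSelf (f i)) : Fin (n + 1) → Localization.Away (f i)) : MvPolynomial (Fin (n + 1)) k →ₐ[k] Localization.Away (f i)))) ∈ P → ∃ (r e : ℕ) (x : Fin r → Localization.AtPrime P) (y : Fin e → Localization.AtPrime P), 1 ≤ r ∧ ringKrullDim (Localization.AtPrime P) = ((r + e : ℕ) : WithBot ℕ∞) ∧ Ideal.span (Set.range x ∪ Set.range y) = IsLocalRing.maximalIdeal (Localization.AtPrime P) ∧ (Ideal.span {algebraMap (MvPolynomial (Fin (n + 1)) k ⧸ RingHom.ker (MvPolynomial.aeval (Fin.cons (IsLocalization.Away.invSelf (f i)) (fun j => algebraMap (Localization.Away (Ideal.Quotient.mk I g)) (Localization.Away (f i)) (f j) * IsLocalization.Away.invSelf (f i)) : Fin (n + 1) → Localization.Away (f i)) : MvPolynomial (Fin (n + 1)) k →ₐ[k] Localization.Away (f i))) (Localization.AtPrime P) (Ideal.Quotient.mk (RingHom.ker (MvPolynomial.aeval (Fin.cons (IsLocalization.Away.invSelf (f i)) (fun j =>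 algebraMap (Localization.Away (Ideal.Quotient.mk I g)) (Localization.Away (f i)) (f j) * IsLocalization.Away.invSelf (f i)) : Fin (n + 1) → Localization.Away (f i)) : MvPolynomial (Fin (n + 1)) k →ₐ[k] Localization.Away (f i))) (MvPolynomial.X 0) : (MvPolynomial (Fin (n + 1)) k ⧸ RingHom.ker (MvPolynomial.aeval (Fin.cons (IsLocalization.Away.invSelf (f i)) (fun j => algebraMap (Localization.Away (Ideal.Quotient.mk I g)) (Localization.Away (f i)) (f j) * IsLocalization.Away.invSelf (f i)) : Fin (n + 1) → Localization.Away (f i)) : MvPolynomial (Fin (n + 1)) k →ₐ[k] Localization.Away (f i))))}).radical = Ideal.span {∏ l, x l}) := Iff.rfl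

end Bridge

/-- every irreducible component of the hyperplane at infinity is REGULAR: in every chart, for every
minimal prime `Q` over the local equation of infinity and every prime `P ⊇ Q`, the ideal `Q·R_P` of the
(regular) local ring `R_P` is generated by part of a regular system of parameters (`⟺ R_P/Q R_P` regular). -/
def RegularBoundaryComponents (k : Type) [Field k] {N : ℕ} (I : Ideal (Lau k N)) (g : Lau k N) (n : ℕ)
    (f : Fin n → Ag I g) : Prop :=
  ∀ (i : Fin n), ∀ Q ∈ (Ideal.span {tInf f i}).minimalPrimes, ∀ (P : Ideal (Chart f i)) [P.IsPrime], Q ≤ P →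
    ∃ (r e : ℕ) (x : Fin r → Localization.AtPrime P) (y : Fin e → Localization.AtPrime P),
      ringKrullDim (Localization.AtPrime P) = ((r + e : ℕ) : WithBot ℕ∞) ∧
      Ideal.span (Set.range x ∪ Set.range y) = IsLocalRing.maximalIdeal (Localization.AtPrime P) ∧
      Q.map (algebraMap (Chart f i) (Localization.AtPrime P)) = Ideal.span (Set.range x)

/-- MIRROR of the child statement (verbatim one-line term of children.json; after the split the
conclusion of `SncBoundaryClosure_of` is switched to `TropicalLinks.SncBoundaryClosure`, `Iff.rfl`). -/
def SncBoundaryClosure : Prop :=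
  ∀ p : ℕ, p.Prime → ∀ (k : Type) [Field k] [CharP k p] [IsAlgClosed k] (N : ℕ) (I : Ideal (AddMonoidAlgebra k (Fin N → ℤ))), I.IsPrime → ∀ g ∉ I, ∀ (n : ℕ) (f : Fin n → Localization.Away (Ideal.Quotient.mk I g)), (Function.Surjective (MvPolynomial.aeval f : MvPolynomial (Fin n) k →ₐ[k] Localization.Away (Ideal.Quotient.mk I g)) ∧ (∀ (P : Ideal (Localization.Away (Ideal.Quotient.mk I g))) [P.IsPrime], IsRegularLocalRing (Localization.AtPrime P)) ∧ ∀ (i : Fin n) (P : Ideal (MvPolynomial (Fin (n + 1)) k ⧸ RingHom.ker (MvPolynomial.aeval (Fin.cons (IsLocalization.Away.invSelf (f i)) (fun j => algebraMap (Localization.Away (Ideal.Quotient.mk I g)) (Localization.Away (f i)) (f j) * IsLocalization.Away.invSelf (f i)) : Fin (n + 1) → Localization.Away (f i)) : MvPolynomial (Fin (n + 1)) k →ₐ[k] Localization.Away (f i)))) [P.IsPrime], IsRegularLocalRing (Localization.AtPrime P)) → ∃ g' ∉ I, ∃ (n' : ℕ) (f' : Fin n' → Localization.Away (Ideal.Quotient.mk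 I g')), (Function.Surjective (MvPolynomial.aeval f' : MvPolynomial (Fin n') k →ₐ[k] Localization.Away (Ideal.Quotient.mk I g')) ∧ (∀ (P : Ideal (Localization.Away (Ideal.Quotient.mk I g'))) [P.IsPrime], IsRegularLocalRing (Localization.AtPrime P)) ∧ ∀ (i : Fin n') (P : Ideal (MvPolynomial (Fin (n' + 1)) k ⧸ RingHom.ker (MvPolynomial.aeval (Fin.cons (IsLocalization.Away.invSelf (f' i)) (fun j => algebraMap (Localization.Away (Ideal.Quotient.mk I g')) (Localization.Away (f' i)) (f' j) * IsLocalization.Away.invSelf (f' i)) : Fin (n' + 1) → Localization.Away (f' i)) : MvPolynomial (Fin (n' + 1)) k →ₐ[k] Localization.Away (f' i)))) [P.IsPrime], IsRegularLocalRing (Localization.AtPrime P)) ∧ (∀ (i : Fin n') (P : Ideal (MvPolynomial (Fin (n' + 1)) k ⧸ RingHom.ker (MvPolynomial.aeval (Fin.cons (IsLocalization.Away.invSelf (f' i)) (fun j => algebraMap (Localization.Away (Ideal.Quotient.mk I g')) (Localization.Away (f' i)) (f' j) * IsLocalization.Away.invSelf (f' i)) : Fin (n' + 1) → Localization.Away (f'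 i)) : MvPolynomial (Fin (n' + 1)) k →ₐ[k] Localization.Away (f' i)))) [P.IsPrime], (Ideal.Quotient.mk (RingHom.ker (MvPolynomial.aeval (Fin.cons (IsLocalization.Away.invSelf (f' i)) (fun j => algebraMap (Localization.Away (Ideal.Quotient.mk I g')) (Localization.Away (f' i)) (f' j) * IsLocalization.Away.invSelf (f' i)) : Fin (n' + 1) → Localization.Away (f' i)) : MvPolynomial (Fin (n' + 1)) k →ₐ[k] Localization.Away (f' i))) (MvPolynomial.X 0) : (MvPolynomial (Fin (n' + 1)) k ⧸ RingHom.ker (MvPolynomial.aeval (Fin.cons (IsLocalization.Away.invSelf (f' i)) (fun j => algebraMap (Localization.Away (Ideal.Quotient.mk I g')) (Localization.Away (f' i)) (f' j) * IsLocalization.Away.invSelf (f' i)) : Fin (n' + 1) → Localization.Away (f' i)) : MvPolynomial (Fin (n' + 1)) k →ₐ[k] Localization.Away (f' i)))) ∈ P → ∃ (r e : ℕ) (x : Fin r → Localization.AtPrime P) (y : Fin e → Localization.AtPrime P), 1 ≤ r ∧ ringKrullDim (Localization.AtPrime P) = ((r + e : ℕ) : WithBot ℕ∞) ∧ Ideal.span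 (Set.range x ∪ Set.range y) = IsLocalRing.maximalIdeal (Localization.AtPrime P) ∧ (Ideal.span {algebraMap (MvPolynomial (Fin (n' + 1)) k ⧸ RingHom.ker (MvPolynomial.aeval (Fin.cons (IsLocalization.Away.invSelf (f' i)) (fun j => algebraMap (Localization.Away (Ideal.Quotient.mk I g')) (Localization.Away (f' i)) (f' j) * IsLocalization.Away.invSelf (f' i)) : Fin (n' + 1) → Localization.Away (f' i)) : MvPolynomial (Fin (n' + 1)) k →ₐ[k] Localization.Away (f' i))) (Localization.AtPrime P) (Ideal.Quotient.mk (RingHom.ker (MvPolynomial.aeval (Fin.cons (IsLocalization.Away.invSelf (f' i)) (fun j => algebraMap (Localization.Away (Ideal.Quotient.mk I g')) (Localization.Away (f' i)) (f' j) * IsLocalization.Away.invSelf (f' i)) : Fin (n' + 1) → Localization.Away (f' i)) : MvPolynomial (Fin (n' + 1)) k →ₐ[k] Localization.Away (f' i))) (MvPolynomial.X 0) : (MvPolynomial (Fin (n' + 1)) k ⧸ RingHom.ker (MvPolynomial.aeval (Fin.cons (IsLocalization.Away.invSelf (f' i)) (fun j => algebraMap (Localization.Away (Ideal.Quotient.mk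 I g')) (Localization.Away (f' i)) (f' j) * IsLocalization.Away.invSelf (f' i)) : Fin (n' + 1) → Localization.Away (f' i)) : MvPolynomial (Fin (n' + 1)) k →ₐ[k] Localization.Away (f' i))))}).radical = Ideal.span {∏ l, x l})

/-- STUB 1 (componentwise weak embedded resolution of the boundary): from a regular projective closure of
some `U_g` one reaches a regular projective closure of some `U_{g'}` all of whose boundary components are
regular. Open in dimension `≥ 4` (the components are the divisors at infinity, of dimension `≥ 3`). -/
theorem stub_regularComponents :
    ∀ p : ℕ, p.Prime → ∀ (k : Type) [Field k] [CharP k p] [IsAlgClosed k] (N : ℕ) (I : Ideal (Lau k N)),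
      I.IsPrime → ∀ g ∉ I, ∀ (n : ℕ) (f : Fin n → Ag I g), RegularClosureDatum k I g n f →
        ∃ g' ∉ I, ∃ (n' : ℕ) (f' : Fin n' → Ag I g'),
          RegularClosureDatum k I g' n' f' ∧ RegularBoundaryComponents k I g' n' f' := by
  sorry

/-- STUB 2 (transversalisation): regular boundary components ⇒ (for some principal open, some affine
embedding) a regular projective closure whose hyperplane at infinity is a strict normal crossings
divisor. -/
theorem stub_normalCrossings :
    ∀ p : ℕ, p.Prime → ∀ (k : Type) [Field k] [CharP k p] [IsAlgClosed k] (N : ℕ) (I : Ideal (Lau k N)),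
      I.IsPrime → ∀ g ∉ I, ∀ (n : ℕ) (f : Fin n → Ag I g),
        RegularClosureDatum k I g n f → RegularBoundaryComponents k I g n f →
        ∃ g' ∉ I, ∃ (n' : ℕ) (f' : Fin n' → Ag I g'),
          RegularClosureDatum k I g' n' f' ∧ SncBoundaryDatum k I g' n' f' := by
  sorry

set_option maxHeartbeats 400000 in
/-- COMPOSITION (kernel-checked, no sorry of its own): the two stubs give the piece. -/
theorem SncBoundaryClosure_of
    (h₁ : ∀ p : ℕ, p.Prime → ∀ (k : Type) [Field k] [CharP k p] [IsAlgClosed k] (N : ℕ) (I : Ideal (Lau k N)),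
      I.IsPrime → ∀ g ∉ I, ∀ (n : ℕ) (f : Fin n → Ag I g), RegularClosureDatum k I g n f →
        ∃ g' ∉ I, ∃ (n' : ℕ) (f' : Fin n' → Ag I g'),
          RegularClosureDatum k I g' n' f' ∧ RegularBoundaryComponents k I g' n' f')
    (h₂ : ∀ p : ℕ, p.Prime → ∀ (k : Type) [Field k] [CharP k p] [IsAlgClosed k] (N : ℕ) (I : Ideal (Lau k N)),
      I.IsPrime → ∀ g ∉ I, ∀ (n : ℕ) (f : Fin n → Ag I g),
        RegularClosureDatum k I g n f → RegularBoundaryComponents k I g n f →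
        ∃ g' ∉ I, ∃ (n' : ℕ) (f' : Fin n' → Ag I g'),
          RegularClosureDatum k I g' n' f' ∧ SncBoundaryDatum k I g' n' f') :
    SncBoundaryClosure := by
  intro p hp k _ _ _ N I hI g hg n f hf
  -- conversions through the `Iff.rfl` bridges keep every unification syntactic
  have hf' := (regularClosureDatum_iff k I g n f).2 hf
  have H₁ := h₁ p hp k N I hI g hg n f hf'
  rcases H₁ with ⟨g₁, hg₁, n₁, f₁, H⟩
  have H₂ := h₂ p hp k N I hI g₁ hg₁ n₁ f₁ H.1 H.2
  rcases H₂ with ⟨g₂, hg₂, n₂, f₂, H'⟩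
  have hf₂' := (regularClosureDatum_iff k I g₂ n₂ f₂).1 H'.1
  have hs₂' := (sncBoundaryDatum_iff k I g₂ n₂ f₂).1 H'.2
  exact ⟨g₂, hg₂, n₂, f₂, hf₂', hs₂'⟩

/-- The piece from the stubs as stated. -/
theorem SncBoundaryClosure_holds : SncBoundaryClosure :=
  SncBoundaryClosure_of stub_regularComponents stub_normalCrossings

end Summit.ResolutionOfSingularities.ResolutionOfSingularities.Cruxes.SncBoundaryClosure.Birth
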